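import Mathlib.LinearAlgebra.FiniteDimensional.Lemmas
import Mathlib.LinearAlgebra.Dimension.Constructions
import Mathlib.Algebra.Field.ZMod
import HarnessLib

/-!
# The canonical closure of a linear system with respect to blocks: deficiency, uniqueness, monotonicity, amortised size bound

Efremenko–Garlík–Itsykson [STOC 2024, §3–§4] attach to every set `F` of linear forms over `𝔽₂` on
BLOCKED variables (block `x` = the `ℓ` variables `x·ℓ + j`, `j < ℓ`; one block per pigeon of the
binary pigeonhole principle, one block per variable of a lifted formula) its CLOSURE `Cl(F)`, the
inclusion-minimal set of blocks `S` such that `F` restricted to the variables outside `S` is SAFE (its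
span contains no `k` independent forms living on fewer than `k` blocks); they prove it unique
(Lemma 4.4), monotone (Alekseev–Itsykson 2025, Lemmas 2.5–2.6) and small: `|Cl(F)| + dim⟨F[∖Cl(F)]⟩
≤ dim⟨F⟩` (EGI24 Lemma 4.7/4.9 = AI25 Lemma 2.7, the amortised form used by the Prover–Delayer
strategy of EGI24 Thm 5.8). The tree so far only had EXISTENTIAL closures (`AffSys.exists_closure`,
`exists_blockClosure`, `exists_gadgetClosure`: some maximiser of a deficiency). This file gives the
CANONICAL one, for a finite-dimensional space `W` of forms (vectors `ℕ → 𝔽₂`) supported in finitely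
many blocks:

* `coordSub A` — the vectors supported in `A ⊆ ℕ`; `blockVars ℓ S` — the variables of the blocks `S`;
* `gRank ℓ W S = dim (W ∩ 𝔽₂^{blockVars S})` and the DEFICIENCY `deficiency ℓ W S = gRank − |S|`
  (so `F[∖S]` is safe iff no `T ⊇ S` has larger deficiency); `gRank` is SUPERMODULAR
  (`gRank_supermodular`), hence so is the deficiency, and the set of its maximisers is closed under
  intersection (`IsMaxDef.inter`);
* `canClosure ℓ W` — the LEAST maximiser of the deficiency (exists and is unique:
  `isMaxDef_canClosure`, `canClosure_subset`), i.e. EGI24's `Cl` (their algorithm stops exactly at the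
  least maximiser; uniqueness = Lemma 4.4);
* MONOTONICITY `canClosure_mono : W ≤ W' → Cl W ⊆ Cl W'` (via the monotonicity in `S` of
  `S ↦ dim(W' ∩ 𝔽₂^S) − dim(W ∩ 𝔽₂^S)`, `gRank_diff_mono`);
* the POTENTIAL `clPotential ℓ W = |Cl W| + (dim W − gRank (Cl W))` (= `|Cl| + dim W[∖Cl]`) with
  `|Cl W| ≤ clPotential ≤ dim W` (`card_canClosure_le_clPotential`, `clPotential_le_finrank` — the
  amortised size bound) and, for `W ≤ W'` with `dim W' ≤ dim W + 1` (one new form): `clPotential W ≤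
  clPotential W' ≤ clPotential W + 1` (`clPotential_mono`, `clPotential_le_succ`), and the STAR CASE
  `clPotential W' = clPotential W + 1 → Cl W' = Cl W ∧ W' ∩ (W + 𝔽₂^{blockVars Cl}) = W`
  (`canClosure_eq_of_clPotential_eq_succ`, `inf_sup_coordSub_eq_of_clPotential_eq_succ`: the closure
  does not move and the new form is independent even after freezing the closure's variables — the
  hypothesis of EGI24 Lemma 5.3).

Everything is finite-dimensional linear algebra over `𝔽₂` (`Submodule.finrank_sup_add_finrank_inf_eq`)
plus arithmetic of maximisers; no matroids. Freeness of the variables outside the canonical closure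
(Rado) and the Prover–Delayer application are in separate files.

## References

* K. Efremenko, M. Garlík, D. Itsykson, *Lower bounds for regular resolution over parities*, STOC 2024
  (SIAM J. Comput. 2025) = ECCC TR23-187, §3 (safe / dangerous), §4 (closure: Algorithm 4.1, Lemmas
  4.4, 4.5, 4.7, 4.9), §5.2 (the potential `|Cl F| + dim⟨F[∖Cl F]⟩`) [EfremenkoGarlikItsykson2024].
* Y. Alekseev, D. Itsykson, STOC 2025 = ECCC TR24-128, §2.5 (Lemmas 2.4–2.7) [AlekseevItsykson2025].
-/

namespace Literature.Computability.MetaComplexity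

open Module Submodule

/-! ### Coordinate subspaces and blocks -/

/-- The vectors `ℕ → 𝔽₂` supported in the finite set `A`. [folklore] -/
def coordSub (A : Finset ℕ) : Submodule (ZMod 2) (ℕ → ZMod 2) where
  carrier := {v | ∀ i, i ∉ A → v i = 0}
  add_mem' := by
    intro v w hv hw i hi
    simp [hv i hi, hw i hi]
  zero_mem' := by intro i _; rfl
  smul_mem' := by
    intro c v hv i hi
    simp [hv i hi]

/-- Membership in a coordinate subspace. [folklore] -/
theorem mem_coordSub {A : Finset ℕ} {v : ℕ → ZMod 2} : v ∈ coordSub A ↔ ∀ i, i ∉ A → v i = 0 :=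
  Iff.rfl

/-- Coordinate subspaces are monotone. [folklore] -/
theorem coordSub_mono {A B : Finset ℕ} (h : A ⊆ B) : coordSub A ≤ coordSub B :=
  fun _ hv i hi => hv i fun hA => hi (h hA)

/-- Meets of coordinate subspaces. [folklore] -/
theorem coordSub_inf (A B : Finset ℕ) : coordSub A ⊓ coordSub B = coordSub (A ∩ B) := by
  ext v
  simp only [Submodule.mem_inf, mem_coordSub, Finset.mem_inter, not_and_or]
  constructor
  · rintro ⟨hA, hB⟩ i (hi | hi)
    · exact hA i hi
    · exact hB i hi
  · intro h
    exact ⟨fun i hi => h i (Or.inl hi), fun i hi => h i (Or.inr hi)⟩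

/-- The variables of the blocks `S` (block `x` = `{x·ℓ + j : j < ℓ}`). [Efremenko–Garlík–Itsykson
2024, §2.5] [cite: EfremenkoGarlikItsykson2024, §2.5] -/
def blockVars (ℓ : ℕ) (S : Finset ℕ) : Finset ℕ :=
  S.biUnion fun x => (Finset.range ℓ).image fun j => x * ℓ + j

/-- Membership in `blockVars`. [folklore] -/
theorem mem_blockVars {ℓ : ℕ} (hℓ : 0 < ℓ) {S : Finset ℕ} {v : ℕ} :
    v ∈ blockVars ℓ S ↔ v / ℓ ∈ S := by
  unfold blockVars
  simp only [Finset.mem_biUnion, Finset.mem_image, Finset.mem_range]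
  constructor
  · rintro ⟨x, hx, j, hj, rfl⟩
    have : (x * ℓ + j) / ℓ = x := by
      rw [Nat.add_comm, Nat.add_mul_div_right _ _ hℓ, Nat.div_eq_of_lt hj, zero_add]
    rwa [this]
  · intro h
    exact ⟨v / ℓ, h, v % ℓ, Nat.mod_lt v hℓ, by rw [Nat.mul_comm]; exact Nat.div_add_mod v ℓ⟩

/-- `blockVars` is monotone. [folklore] -/
theorem blockVars_mono {ℓ : ℕ} {S T : Finset ℕ} (h : S ⊆ T) : blockVars ℓ S ⊆ blockVars ℓ T :=
  Finset.biUnion_subset_biUnion_of_subset_left _ h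

/-- `blockVars` of an intersection (blocks are disjoint). [folklore] -/
theorem blockVars_inter {ℓ : ℕ} (hℓ : 0 < ℓ) (S T : Finset ℕ) :
    blockVars ℓ (S ∩ T) = blockVars ℓ S ∩ blockVars ℓ T := by
  ext v
  simp [mem_blockVars hℓ]

/-- `blockVars` of a union. [folklore] -/
theorem blockVars_union {ℓ : ℕ} (hℓ : 0 < ℓ) (S T : Finset ℕ) :
    blockVars ℓ (S ∪ T) = blockVars ℓ S ∪ blockVars ℓ T := by
  ext v
  simp [mem_blockVars hℓ]

/-! ### The block rank function `S ↦ dim (W ∩ 𝔽₂^{blockVars S})` and the deficiency -/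

section Deficiency

variable (ℓ : ℕ) (W : Submodule (ZMod 2) (ℕ → ZMod 2))

/-- `gRank ℓ W S = dim (W ∩ 𝔽₂^{blockVars ℓ S})`: the number of independent forms of `W` living
entirely inside the blocks `S`. [Efremenko–Garlík–Itsykson 2024, §3 (dangerous sets: `k` independent
forms on `< k` blocks)] [cite: EfremenkoGarlikItsykson2024, §3] -/
noncomputable def gRank (S : Finset ℕ) : ℕ :=
  finrank (ZMod 2) (W ⊓ coordSub (blockVars ℓ S) : Submodule (ZMod 2) (ℕ → ZMod 2))

/-- The DEFICIENCY `deficiency ℓ W S = gRank ℓ W S − |S|` (an integer). Positive deficiency of some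
`S` = "`W` contains a dangerous set supported in `S`". [Efremenko–Garlík–Itsykson 2024, §3–§4]
[cite: EfremenkoGarlikItsykson2024, §4] -/
noncomputable def deficiency (S : Finset ℕ) : ℤ :=
  (gRank ℓ W S : ℤ) - (S.card : ℤ)

/-- `S` MAXIMISES the deficiency of `W` (globally, over all finite sets of blocks).
[Efremenko–Garlík–Itsykson 2024, §4] [cite: EfremenkoGarlikItsykson2024, §4] -/
def IsMaxDef (S : Finset ℕ) : Prop :=
  ∀ T : Finset ℕ, deficiency ℓ W T ≤ deficiency ℓ W S

/-- **The canonical closure** `Cl(W)` of Efremenko–Garlík–Itsykson: the least maximiser of the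
deficiency (when `W` is supported in finitely many blocks; `∅` otherwise, a case never used).
[Efremenko–Garlík–Itsykson 2024, §4 (closure), Lemma 4.4 (uniqueness)] [cite: EfremenkoGarlikItsykson2024, §4] -/
noncomputable def canClosure : Finset ℕ := by
  classical
  exact if h : ∃ S : Finset ℕ, IsMaxDef ℓ W S ∧ ∀ T, IsMaxDef ℓ W T → S ⊆ T then h.choose else ∅

/-- **The potential** `clPotential ℓ W = |Cl(W)| + (dim W − g(Cl(W)))` = `|Cl(W)| + dim W[∖Cl(W)]`,
the quantity that "records the number of coins" in the Prover–Delayer strategy of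
[Efremenko–Garlík–Itsykson 2024, Thm 5.8 (proof)]; equivalently `dim W − max deficiency`.
[cite: EfremenkoGarlikItsykson2024, Theorem 5.8] -/
noncomputable def clPotential : ℕ :=
  (canClosure ℓ W).card + (finrank (ZMod 2) W - gRank ℓ W (canClosure ℓ W))

end Deficiency

section Basic

variable {ℓ : ℕ} {W : Submodule (ZMod 2) (ℕ → ZMod 2)}

/-- Unfolding the deficiency. [folklore] -/
theorem deficiency_def (S : Finset ℕ) :
    deficiency ℓ W S = (gRank ℓ W S : ℤ) - (S.card : ℤ) := rfl

/-- The deficiency of `∅` is `0`. [folklore] -/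
@[simp] theorem deficiency_empty : deficiency ℓ W ∅ = 0 := by
  rw [deficiency_def, Finset.card_empty]
  have : gRank ℓ W ∅ = 0 := by
    unfold gRank
    have h : (W ⊓ coordSub (blockVars ℓ ∅) : Submodule (ZMod 2) (ℕ → ZMod 2)) = ⊥ := by
      rw [eq_bot_iff]
      intro v hv
      rw [Submodule.mem_bot]
      funext i
      exact (Submodule.mem_inf.1 hv).2 i (by simp [blockVars])
    rw [h, finrank_bot]
  simp [this]

variable [FiniteDimensional (ZMod 2) W]

/-- `gRank` is monotone in `S`. [folklore] -/
theorem gRank_mono {S T : Finset ℕ} (h : S ⊆ T) : gRank ℓ W S ≤ gRank ℓ W T := by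
  unfold gRank
  exact Submodule.finrank_mono (inf_le_inf_left W (coordSub_mono (blockVars_mono h)))

/-- `gRank ≤ dim W`. [folklore] -/
theorem gRank_le_finrank (S : Finset ℕ) : gRank ℓ W S ≤ finrank (ZMod 2) W := by
  unfold gRank
  exact Submodule.finrank_mono inf_le_left

/-- The dimension inequality behind supermodularity: `dim X + dim Y ≤ dim Z + dim (X ∩ Y)` for
`X, Y ≤ Z` finite-dimensional. [folklore] -/
theorem finrank_add_le_of_le {X Y Z : Submodule (ZMod 2) (ℕ → ZMod 2)} [FiniteDimensional (ZMod 2) Z]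
    (hX : X ≤ Z) (hY : Y ≤ Z) :
    finrank (ZMod 2) X + finrank (ZMod 2) Y ≤
      finrank (ZMod 2) Z + finrank (ZMod 2) (X ⊓ Y : Submodule (ZMod 2) (ℕ → ZMod 2)) := by
  haveI : FiniteDimensional (ZMod 2) X := Submodule.finiteDimensional_of_le hX
  haveI : FiniteDimensional (ZMod 2) Y := Submodule.finiteDimensional_of_le hY
  rw [← Submodule.finrank_sup_add_finrank_inf_eq X Y]
  exact Nat.add_le_add_right (Submodule.finrank_mono (sup_le hX hY)) _

/-- **Supermodularity of the block rank**: `g(S ∪ T) + g(S ∩ T) ≥ g(S) + g(T)`.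
[Efremenko–Garlík–Itsykson 2024, §4 (behind the uniqueness of the closure, Lemma 4.4)] [folklore] -/
theorem gRank_supermodular (hℓ : 0 < ℓ) (S T : Finset ℕ) :
    gRank ℓ W S + gRank ℓ W T ≤ gRank ℓ W (S ∪ T) + gRank ℓ W (S ∩ T) := by
  unfold gRank
  have hX : W ⊓ coordSub (blockVars ℓ S) ≤ W ⊓ coordSub (blockVars ℓ (S ∪ T)) :=
    inf_le_inf_left W (coordSub_mono (blockVars_mono Finset.subset_union_left))
  have hY : W ⊓ coordSub (blockVars ℓ T) ≤ W ⊓ coordSub (blockVars ℓ (S ∪ T)) :=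
    inf_le_inf_left W (coordSub_mono (blockVars_mono Finset.subset_union_right))
  have h := finrank_add_le_of_le hX hY
  have hinf : (W ⊓ coordSub (blockVars ℓ S)) ⊓ (W ⊓ coordSub (blockVars ℓ T)) =
      W ⊓ coordSub (blockVars ℓ (S ∩ T)) := by
    rw [inf_inf_inf_comm, inf_idem, coordSub_inf, ← blockVars_inter hℓ]
  rw [hinf] at h
  exact h

/-- Supermodularity of the deficiency. [Efremenko–Garlík–Itsykson 2024, §4] [folklore] -/
theorem deficiency_supermodular (hℓ : 0 < ℓ) (S T : Finset ℕ) :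
    deficiency ℓ W S + deficiency ℓ W T ≤ deficiency ℓ W (S ∪ T) + deficiency ℓ W (S ∩ T) := by
  simp only [deficiency_def]
  have h := gRank_supermodular (W := W) hℓ S T
  have hc : (S ∪ T).card + (S ∩ T).card = S.card + T.card := Finset.card_union_add_card_inter S T
  omega

/-- Maximisers of the deficiency are closed under intersection. [Efremenko–Garlík–Itsykson 2024,
Lemma 4.4 (uniqueness of the closure)] [cite: EfremenkoGarlikItsykson2024, Lemma 4.4] -/
theorem IsMaxDef.inter (hℓ : 0 < ℓ) {S T : Finset ℕ} (hS : IsMaxDef ℓ W S) (hT : IsMaxDef ℓ W T) :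
    IsMaxDef ℓ W (S ∩ T) := by
  intro U
  have h1 := deficiency_supermodular (W := W) hℓ S T
  have h2 := hS (S ∪ T)
  have h4 := hT U
  omega

omit [FiniteDimensional (ZMod 2) W] in
/-- Adding blocks not met by `W` lowers the deficiency: if `W` is supported in the blocks `B`, then
`d(T ∩ B) ≥ d(T)`, with `>` unless `T ⊆ B`. [folklore] -/
theorem deficiency_inter_support {B : Finset ℕ} (hB : W ≤ coordSub (blockVars ℓ B)) (hℓ : 0 < ℓ)
    (T : Finset ℕ) : deficiency ℓ W T + ((T \ B).card : ℤ) = deficiency ℓ W (T ∩ B) := by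
  simp only [deficiency_def]
  have hg : gRank ℓ W T = gRank ℓ W (T ∩ B) := by
    have heq : W ⊓ coordSub (blockVars ℓ T) = W ⊓ coordSub (blockVars ℓ (T ∩ B)) := by
      apply le_antisymm
      · intro v hv
        obtain ⟨hvW, hvT⟩ := Submodule.mem_inf.1 hv
        refine Submodule.mem_inf.2 ⟨hvW, ?_⟩
        have hvB := hB hvW
        have : v ∈ coordSub (blockVars ℓ T) ⊓ coordSub (blockVars ℓ B) :=
          Submodule.mem_inf.2 ⟨hvT, hvB⟩
        rwa [coordSub_inf, ← blockVars_inter hℓ] at this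
      · exact inf_le_inf_left W (coordSub_mono (blockVars_mono Finset.inter_subset_left))
    unfold gRank
    rw [heq]
  have hc : (T ∩ B).card + (T \ B).card = T.card := Finset.card_inter_add_card_sdiff T B
  rw [hg]
  omega

omit [FiniteDimensional (ZMod 2) W] in
/-- A maximiser over the subsets of a support `B` of `W` is a global maximiser. [folklore] -/
theorem isMaxDef_of_forall_subset {B : Finset ℕ} (hB : W ≤ coordSub (blockVars ℓ B)) (hℓ : 0 < ℓ)
    {S : Finset ℕ} (hS : ∀ T ⊆ B, deficiency ℓ W T ≤ deficiency ℓ W S) : IsMaxDef ℓ W S := by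
  intro T
  have h1 := deficiency_inter_support hB hℓ T
  have h2 := hS (T ∩ B) Finset.inter_subset_right
  have h3 : (0 : ℤ) ≤ ((T \ B).card : ℤ) := Int.natCast_nonneg _
  omega

omit [FiniteDimensional (ZMod 2) W] in
/-- Maximisers exist (within any support of `W`). [Efremenko–Garlík–Itsykson 2024, §4 (the closure
algorithm terminates)] [folklore] -/
theorem exists_isMaxDef {B : Finset ℕ} (hB : W ≤ coordSub (blockVars ℓ B)) (hℓ : 0 < ℓ) :
    ∃ S ⊆ B, IsMaxDef ℓ W S := by
  obtain ⟨S, hS, hmax⟩ := Finset.exists_max_image B.powerset (deficiency ℓ W)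
    ⟨∅, Finset.empty_mem_powerset B⟩
  rw [Finset.mem_powerset] at hS
  exact ⟨S, hS, isMaxDef_of_forall_subset hB hℓ fun T hT => hmax T (Finset.mem_powerset.2 hT)⟩

omit [FiniteDimensional (ZMod 2) W] in
/-- A maximiser lies inside every support of `W`. [folklore] -/
theorem IsMaxDef.subset_support {B : Finset ℕ} (hB : W ≤ coordSub (blockVars ℓ B)) (hℓ : 0 < ℓ)
    {S : Finset ℕ} (hS : IsMaxDef ℓ W S) : S ⊆ B := by
  have h1 := deficiency_inter_support hB hℓ S
  have h2 := hS (S ∩ B)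
  have h0 : ((S \ B).card : ℤ) ≤ 0 := by omega
  have : (S \ B).card = 0 := by exact_mod_cast le_antisymm h0 (Int.natCast_nonneg _)
  rw [Finset.card_eq_zero, Finset.sdiff_eq_empty_iff_subset] at this
  exact this

omit [FiniteDimensional (ZMod 2) W] in
/-- The maximal deficiency is nonnegative (`d(∅) = 0`). [folklore] -/
theorem IsMaxDef.nonneg {S : Finset ℕ} (hS : IsMaxDef ℓ W S) : 0 ≤ deficiency ℓ W S := by
  have := hS ∅
  rwa [deficiency_empty] at this

/-! ### The canonical closure: the least maximiser -/

/-- There is a LEAST maximiser of the deficiency (a maximiser of minimum cardinality is contained in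
every maximiser, by closure under intersection). [Efremenko–Garlík–Itsykson 2024, Lemma 4.4]
[cite: EfremenkoGarlikItsykson2024, Lemma 4.4] -/
theorem exists_least_isMaxDef {B : Finset ℕ} (hB : W ≤ coordSub (blockVars ℓ B)) (hℓ : 0 < ℓ) :
    ∃ S : Finset ℕ, IsMaxDef ℓ W S ∧ ∀ T, IsMaxDef ℓ W T → S ⊆ T := by
  classical
  obtain ⟨S₁, -, hS₁⟩ := exists_isMaxDef hB hℓ
  obtain ⟨S, hS, hmin⟩ := Finset.exists_min_image
    (B.powerset.filter fun S => IsMaxDef ℓ W S) Finset.card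
    ⟨S₁, Finset.mem_filter.2 ⟨Finset.mem_powerset.2 (hS₁.subset_support hB hℓ), hS₁⟩⟩
  rw [Finset.mem_filter] at hS
  refine ⟨S, hS.2, fun T hT => ?_⟩
  have hST : IsMaxDef ℓ W (S ∩ T) := hS.2.inter hℓ hT
  have hle := hmin (S ∩ T) (Finset.mem_filter.2
    ⟨Finset.mem_powerset.2 (Finset.inter_subset_left.trans (Finset.mem_powerset.1 hS.1)), hST⟩)
  have heq : S ∩ T = S := Finset.eq_of_subset_of_card_le Finset.inter_subset_left hle
  exact heq ▸ Finset.inter_subset_right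

/-- The canonical closure is a maximiser of the deficiency. [Efremenko–Garlík–Itsykson 2024, §4]
[cite: EfremenkoGarlikItsykson2024, §4] -/
theorem isMaxDef_canClosure {B : Finset ℕ} (hB : W ≤ coordSub (blockVars ℓ B)) (hℓ : 0 < ℓ) :
    IsMaxDef ℓ W (canClosure ℓ W) := by
  classical
  have h := exists_least_isMaxDef hB hℓ
  unfold canClosure
  rw [dif_pos h]
  exact h.choose_spec.1

/-- The canonical closure is contained in every maximiser (uniqueness / minimality).
[Efremenko–Garlík–Itsykson 2024, Lemma 4.4] [cite: EfremenkoGarlikItsykson2024, Lemma 4.4] -/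
theorem canClosure_subset {B : Finset ℕ} (hB : W ≤ coordSub (blockVars ℓ B)) (hℓ : 0 < ℓ)
    {T : Finset ℕ} (hT : IsMaxDef ℓ W T) : canClosure ℓ W ⊆ T := by
  classical
  have h := exists_least_isMaxDef hB hℓ
  unfold canClosure
  rw [dif_pos h]
  exact h.choose_spec.2 T hT

/-- The canonical closure lies inside every support of `W` (it only contains blocks met by `W`).
[Efremenko–Garlík–Itsykson 2024, §4] [cite: EfremenkoGarlikItsykson2024, §4] -/
theorem canClosure_subset_support {B : Finset ℕ} (hB : W ≤ coordSub (blockVars ℓ B)) (hℓ : 0 < ℓ) :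
    canClosure ℓ W ⊆ B :=
  (isMaxDef_canClosure hB hℓ).subset_support hB hℓ

/-- SIZE BOUND `|Cl(W)| ≤ g(Cl(W)) ≤ dim W` (the deficiency of the closure is `≥ 0`).
[Efremenko–Garlík–Itsykson 2024, Lemma 4.7; Alekseev–Itsykson 2025, Lemma 2.7] [cite: EfremenkoGarlikItsykson2024, Lemma 4.7] -/
theorem card_canClosure_le_gRank {B : Finset ℕ} (hB : W ≤ coordSub (blockVars ℓ B)) (hℓ : 0 < ℓ) :
    (canClosure ℓ W).card ≤ gRank ℓ W (canClosure ℓ W) := by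
  have h := (isMaxDef_canClosure hB hℓ).nonneg
  rw [deficiency_def] at h
  omega

end Basic

/-! ### Monotonicity of the closure in `W` -/

section Mono

variable {ℓ : ℕ} {W W' : Submodule (ZMod 2) (ℕ → ZMod 2)}
  [FiniteDimensional (ZMod 2) W] [FiniteDimensional (ZMod 2) W']

omit [FiniteDimensional (ZMod 2) W] in
/-- The increment `S ↦ g_{W'}(S) − g_W(S)` is monotone in `S` for `W ≤ W'`:
`g'(T) + g(S) ≥ g'(S) + g(T)` for `S ⊆ T`. [Alekseev–Itsykson 2025, Lemmas 2.5–2.6 (closure is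
monotone)] [folklore] -/
theorem gRank_diff_mono (hWW' : W ≤ W') {S T : Finset ℕ} (hST : S ⊆ T) :
    gRank ℓ W' S + gRank ℓ W T ≤ gRank ℓ W' T + gRank ℓ W S := by
  unfold gRank
  have hX : W' ⊓ coordSub (blockVars ℓ S) ≤ W' ⊓ coordSub (blockVars ℓ T) :=
    inf_le_inf_left W' (coordSub_mono (blockVars_mono hST))
  have hY : W ⊓ coordSub (blockVars ℓ T) ≤ W' ⊓ coordSub (blockVars ℓ T) := inf_le_inf_right _ hWW'
  have h := finrank_add_le_of_le hX hY
  have hinf : (W' ⊓ coordSub (blockVars ℓ S)) ⊓ (W ⊓ coordSub (blockVars ℓ T)) =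
      W ⊓ coordSub (blockVars ℓ S) := by
    apply le_antisymm
    · intro v hv
      obtain ⟨h1, h2⟩ := Submodule.mem_inf.1 hv
      exact Submodule.mem_inf.2 ⟨(Submodule.mem_inf.1 h2).1, (Submodule.mem_inf.1 h1).2⟩
    · intro v hv
      obtain ⟨h1, h2⟩ := Submodule.mem_inf.1 hv
      exact Submodule.mem_inf.2 ⟨Submodule.mem_inf.2 ⟨hWW' h1, h2⟩,
        Submodule.mem_inf.2 ⟨h1, coordSub_mono (blockVars_mono hST) h2⟩⟩
  rw [hinf] at h
  exact h

omit [FiniteDimensional (ZMod 2) W] in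
/-- The increment is bounded by the dimension gap: `g'(S) − g(S) ≤ dim W' − dim W`. [folklore] -/
theorem gRank_sub_le (hWW' : W ≤ W') (S : Finset ℕ) :
    gRank ℓ W' S + finrank (ZMod 2) W ≤ finrank (ZMod 2) W' + gRank ℓ W S := by
  unfold gRank
  have hX : W' ⊓ coordSub (blockVars ℓ S) ≤ W' := inf_le_left
  have h := finrank_add_le_of_le hX hWW'
  have hinf : (W' ⊓ coordSub (blockVars ℓ S)) ⊓ W = W ⊓ coordSub (blockVars ℓ S) := by
    apply le_antisymm
    · intro v hv
      obtain ⟨h1, h2⟩ := Submodule.mem_inf.1 hv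
      exact Submodule.mem_inf.2 ⟨h2, (Submodule.mem_inf.1 h1).2⟩
    · intro v hv
      obtain ⟨h1, h2⟩ := Submodule.mem_inf.1 hv
      exact Submodule.mem_inf.2 ⟨Submodule.mem_inf.2 ⟨hWW' h1, h2⟩, h1⟩
  rw [hinf] at h
  exact h

omit [FiniteDimensional (ZMod 2) W] in
/-- The deficiency can only grow with `W`. [folklore] -/
theorem deficiency_mono (hWW' : W ≤ W') (S : Finset ℕ) : deficiency ℓ W S ≤ deficiency ℓ W' S := by
  simp only [deficiency_def]
  have : gRank ℓ W S ≤ gRank ℓ W' S := by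
    unfold gRank; exact Submodule.finrank_mono (inf_le_inf_right _ hWW')
  omega

/-- **The closure is monotone**: `W ≤ W' → Cl(W) ⊆ Cl(W')`. [Alekseev–Itsykson 2025, Lemmas 2.5–2.6;
Efremenko–Garlík–Itsykson 2024, §4] [cite: AlekseevItsykson2025, Lemma 2.5] -/
theorem canClosure_mono (hℓ : 0 < ℓ) (hWW' : W ≤ W') {B : Finset ℕ}
    (hB' : W' ≤ coordSub (blockVars ℓ B)) : canClosure ℓ W ⊆ canClosure ℓ W' := by
  have hB : W ≤ coordSub (blockVars ℓ B) := hWW'.trans hB'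
  set S₀ := canClosure ℓ W
  set S₁ := canClosure ℓ W'
  have h₀ : IsMaxDef ℓ W S₀ := isMaxDef_canClosure hB hℓ
  have h₁ : IsMaxDef ℓ W' S₁ := isMaxDef_canClosure hB' hℓ
  -- `S₀ ∩ S₁` is a maximiser for `W`
  have hint : IsMaxDef ℓ W (S₀ ∩ S₁) := by
    intro U
    have hsm := deficiency_supermodular (W := W) hℓ S₀ S₁
    -- `d(S₀ ∪ S₁) ≤ d(S₁)`: from `d'(S₀ ∪ S₁) ≤ d'(S₁)` and the monotone increment
    have hinc := gRank_diff_mono (ℓ := ℓ) hWW' (Finset.subset_union_right : S₁ ⊆ S₀ ∪ S₁)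
    have hmax' := h₁ (S₀ ∪ S₁)
    simp only [deficiency_def] at hmax' hsm ⊢
    have hU := h₀ U
    have hS₁ := h₀ S₁
    simp only [deficiency_def] at hU hS₁
    omega
  have hsub := canClosure_subset hB hℓ hint
  exact fun x hx => (Finset.mem_inter.1 (hsub hx)).2

end Mono

/-! ### The amortised potential `|Cl W| + dim W[∖Cl W]` -/

section Potential

variable {ℓ : ℕ} {W : Submodule (ZMod 2) (ℕ → ZMod 2)} [FiniteDimensional (ZMod 2) W]

omit [FiniteDimensional (ZMod 2) W] in
/-- The closure is at most the potential. [folklore] -/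
theorem card_canClosure_le_clPotential : (canClosure ℓ W).card ≤ clPotential ℓ W :=
  Nat.le_add_right _ _

/-- The potential as `dim W − (maximal deficiency)`, in `ℤ`. [folklore] -/
theorem clPotential_eq {B : Finset ℕ} (hB : W ≤ coordSub (blockVars ℓ B)) (hℓ : 0 < ℓ) :
    (clPotential ℓ W : ℤ) = (finrank (ZMod 2) W : ℤ) - deficiency ℓ W (canClosure ℓ W) := by
  unfold clPotential
  rw [deficiency_def]
  have h1 := gRank_le_finrank (ℓ := ℓ) (W := W) (canClosure ℓ W)
  have h2 := card_canClosure_le_gRank hB hℓ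
  push_cast
  omega

/-- **Amortised size bound** `|Cl(W)| + dim W[∖Cl(W)] ≤ dim W`. [Alekseev–Itsykson 2025, Lemma 2.7;
Efremenko–Garlík–Itsykson 2024, Lemmas 4.7/4.9] [cite: AlekseevItsykson2025, Lemma 2.7] -/
theorem clPotential_le_finrank {B : Finset ℕ} (hB : W ≤ coordSub (blockVars ℓ B)) (hℓ : 0 < ℓ) :
    clPotential ℓ W ≤ finrank (ZMod 2) W := by
  have h := clPotential_eq hB hℓ
  have h0 := (isMaxDef_canClosure hB hℓ).nonneg
  omega

variable {W' : Submodule (ZMod 2) (ℕ → ZMod 2)} [FiniteDimensional (ZMod 2) W']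

/-- The maximal deficiency grows with `W`, by at most the dimension gap. [folklore] -/
theorem deficiency_canClosure_le_add (hℓ : 0 < ℓ) (hWW' : W ≤ W') {B : Finset ℕ}
    (hB' : W' ≤ coordSub (blockVars ℓ B)) :
    deficiency ℓ W (canClosure ℓ W) ≤ deficiency ℓ W' (canClosure ℓ W') ∧
      deficiency ℓ W' (canClosure ℓ W') + (finrank (ZMod 2) W : ℤ) ≤
        deficiency ℓ W (canClosure ℓ W) + (finrank (ZMod 2) W' : ℤ) := by
  have hB : W ≤ coordSub (blockVars ℓ B) := hWW'.trans hB'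
  have h₀ := isMaxDef_canClosure hB hℓ
  have h₁ := isMaxDef_canClosure hB' hℓ
  constructor
  · exact (deficiency_mono hWW' _).trans (h₁ _)
  · have hgap := gRank_sub_le (ℓ := ℓ) hWW' (canClosure ℓ W')
    have hmax := h₀ (canClosure ℓ W')
    simp only [deficiency_def] at hmax ⊢
    omega

/-- **Unit steps**: for `W ≤ W'` with `dim W' ≤ dim W + 1` (one new form),
`clPotential W ≤ clPotential W' ≤ clPotential W + 1`. [Efremenko–Garlík–Itsykson 2024, Thm 5.8 (proof:
"records the number of coins")] [cite: EfremenkoGarlikItsykson2024, Theorem 5.8] -/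
theorem clPotential_mono (hℓ : 0 < ℓ) (hWW' : W ≤ W') {B : Finset ℕ}
    (hB' : W' ≤ coordSub (blockVars ℓ B)) : clPotential ℓ W ≤ clPotential ℓ W' := by
  have hB : W ≤ coordSub (blockVars ℓ B) := hWW'.trans hB'
  have h := deficiency_canClosure_le_add hℓ hWW' hB'
  have e := clPotential_eq hB hℓ
  have e' := clPotential_eq hB' hℓ
  omega

/-- Unit steps, upper bound. [Efremenko–Garlík–Itsykson 2024, Thm 5.8 (proof)]
[cite: EfremenkoGarlikItsykson2024, Theorem 5.8] -/
theorem clPotential_le_succ (hℓ : 0 < ℓ) (hWW' : W ≤ W') {B : Finset ℕ}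
    (hB' : W' ≤ coordSub (blockVars ℓ B)) (hdim : finrank (ZMod 2) W' ≤ finrank (ZMod 2) W + 1) :
    clPotential ℓ W' ≤ clPotential ℓ W + 1 := by
  have hB : W ≤ coordSub (blockVars ℓ B) := hWW'.trans hB'
  have h := deficiency_canClosure_le_add hℓ hWW' hB'
  have e := clPotential_eq hB hℓ
  have e' := clPotential_eq hB' hℓ
  omega

/-- **The star case, closure**: if the potential goes up, the closure does not move.
[Efremenko–Garlík–Itsykson 2024, Thm 5.8 (proof, second bullet) with Lemma 4.9]
[cite: EfremenkoGarlikItsykson2024, Theorem 5.8] -/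
theorem canClosure_eq_of_clPotential_eq_succ (hℓ : 0 < ℓ) (hWW' : W ≤ W') {B : Finset ℕ}
    (hB' : W' ≤ coordSub (blockVars ℓ B)) (hdim : finrank (ZMod 2) W' ≤ finrank (ZMod 2) W + 1)
    (hP : clPotential ℓ W' = clPotential ℓ W + 1) : canClosure ℓ W' = canClosure ℓ W := by
  have hB : W ≤ coordSub (blockVars ℓ B) := hWW'.trans hB'
  have h := deficiency_canClosure_le_add hℓ hWW' hB'
  have e := clPotential_eq hB hℓ
  have e' := clPotential_eq hB' hℓ
  -- the maximal deficiencies agree, hence `Cl W` is a maximiser for `W'`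
  have hMM : deficiency ℓ W' (canClosure ℓ W') = deficiency ℓ W (canClosure ℓ W) := by omega
  have hmax : IsMaxDef ℓ W' (canClosure ℓ W) := by
    intro T
    have h1 := isMaxDef_canClosure hB' hℓ T
    have h2 := deficiency_mono (ℓ := ℓ) hWW' (canClosure ℓ W)
    omega
  exact Finset.Subset.antisymm (canClosure_subset hB' hℓ hmax) (canClosure_mono hℓ hWW' hB')

/-- **The star case, independence**: if the potential goes up, then `W'` meets `W + 𝔽₂^{blockVars Cl}`
only in `W` — a new form is not a combination of old forms and variables of the closure (the
hypothesis "`f[∖Cl(F)] ∉ ⟨F[∖Cl(F)]⟩`" of EGI24 Lemma 5.3). [Efremenko–Garlík–Itsykson 2024, Thm 5.8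
(proof), Lemma 5.3] [cite: EfremenkoGarlikItsykson2024, Lemma 5.3] -/
theorem inf_sup_coordSub_le_of_clPotential_eq_succ (hℓ : 0 < ℓ) (hWW' : W ≤ W') {B : Finset ℕ}
    (hB' : W' ≤ coordSub (blockVars ℓ B)) (hdim : finrank (ZMod 2) W' ≤ finrank (ZMod 2) W + 1)
    (hP : clPotential ℓ W' = clPotential ℓ W + 1) :
    W' ⊓ (W ⊔ coordSub (blockVars ℓ (canClosure ℓ W))) ≤ W := by
  have hB : W ≤ coordSub (blockVars ℓ B) := hWW'.trans hB'
  have hCl := canClosure_eq_of_clPotential_eq_succ hℓ hWW' hB' hdim hP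
  have h := deficiency_canClosure_le_add hℓ hWW' hB'
  have e := clPotential_eq hB hℓ
  have e' := clPotential_eq hB' hℓ
  set C := canClosure ℓ W with hC
  -- the maximal deficiencies agree and `dim W' = dim W + 1`; so `g'(C) = g(C)`
  have hg : gRank ℓ W' C = gRank ℓ W C := by
    have hMM : deficiency ℓ W' (canClosure ℓ W') = deficiency ℓ W C := by omega
    rw [hCl] at hMM
    simp only [deficiency_def] at hMM
    omega
  -- hence `W' ∩ 𝔽₂^{C} = W ∩ 𝔽₂^{C}`
  have hle : W ⊓ coordSub (blockVars ℓ C) ≤ W' ⊓ coordSub (blockVars ℓ C) := inf_le_inf_right _ hWW'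
  have heq : W' ⊓ coordSub (blockVars ℓ C) = W ⊓ coordSub (blockVars ℓ C) := by
    symm
    apply Submodule.eq_of_le_of_finrank_eq hle
    unfold gRank at hg
    exact hg.symm
  -- take `v = w + u ∈ W'` with `w ∈ W`, `u` supported in `C`: then `u ∈ W' ∩ 𝔽₂^C = W ∩ 𝔽₂^C`
  intro v hv
  obtain ⟨hvW', hvsum⟩ := Submodule.mem_inf.1 hv
  obtain ⟨w, hw, u, hu, rfl⟩ := Submodule.mem_sup.1 hvsum
  have huW' : u ∈ W' := by
    have : w + u - w ∈ W' := W'.sub_mem hvW' (hWW' hw)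
    simpa using this
  have hu' : u ∈ W ⊓ coordSub (blockVars ℓ C) := by
    rw [← heq]; exact Submodule.mem_inf.2 ⟨huW', hu⟩
  exact W.add_mem hw (Submodule.mem_inf.1 hu').1

end Potential

end Literature.Computability.MetaComplexity
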